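import Literature.Analysis.FunctionSpaces.PolchinskiKernelRigidity
import Literature.Analysis.FunctionSpaces.PolchinskiSubspaceReduction
import Literature.Analysis.FunctionSpaces.PolchinskiLogSobolevBoundedBelow
import Mathlib.Analysis.InnerProductSpace.PiL2
import Mathlib.Analysis.InnerProductSpace.Projection.Submodule
import HarnessLib

/-!
# [BBD] Theorem 3 — the multiscale Bakry–Émery criterion — DISCHARGED as typed
# (`Polchinski.BauerschmidtBodineau_multiscaleBakryEmery_holds`)

Topic `Literature/Analysis/FunctionSpaces`; the discharge file of the named fact
`Polchinski.BauerschmidtBodineau_multiscaleBakryEmery` (`MultiscaleBakryEmery.lean`; census row B16 of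
cell `ym-ir`).  The `_holds` theorem lives in this sibling file and not in `MultiscaleBakryEmery.lean`
because its proof stands on the forty-file Polchinski tower that IMPORTS `MultiscaleBakryEmery.lean`
(appending it there would close an import cycle) — the pattern of the tree's other discharges in
separate proof files (e.g. `DisagreementPercolationProofs.lean`).

**Proof.**  Let `D = (C_t, Ċ_t, C̈_t, C_∞)` be ANY covariance decomposition of `ℝ^N` (positive
semidefinite, possibly degenerate — [BBD] §3.1 p0012 L56–61), `V₀` measurable and bounded below, and
assume the hypotheses of the fact: `V_t ∈ C²` for `t > 0`, (e:continuity) (not used), the multiscale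
condition (e:assCt-mon) for all `φ` with rates `λ̇_t`, `λ̇` locally integrable, `λ_t = ∫₀^t λ̇`,
`e^{−2λ} ∈ L¹`.
1. KERNEL RIGIDITY (`PolchinskiKernelRigidity.lean`, own argument): `ker C_t = ker C_∞` for every `t > 0`.
2. REDUCTION (`PolchinskiSubspaceReduction.lean`): let `X = (ker C_∞)ᗮ` ([BBD]'s `X = im C_∞`), pick an
   orthonormal frame `L : ℝ^{N'} ≃ X ⊂ ℝ^N` (Mathlib `stdOrthonormalBasis`) with matrix `B`; every
   covariance is blind to `Xᗮ = ker C_∞` (`ker C_∞ ⊆ ker C_t, ker Ċ_t`), so the reduced data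
   `C'_t = Bᵀ C_t B` form a covariance decomposition of `ℝ^{N'}` which, by 1., is NONDEGENERATE
   (`C'_t ≻ 0` for `t > 0`); the Gaussians, potentials (`V'_t = V_t ∘ L`), the multiscale condition (same
   rates) and the measures `ν₀ = L_* ν₀'` all correspond.
3. The tree's theorem for nondegenerate decompositions,
   `Polchinski.logSobolev_of_multiscaleBakryEmery_of_bounded_below` (`PolchinskiLogSobolevBoundedBelow.lean`,
   the g9–g13 programme of this seat's lineage: [BBD] §3.2–3.3 structure, exchange inequality, entropy
   production, restart in the smoothed class), applied to `(C'_t, V₀ ∘ L, f ∘ L)`, is transported back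
   along `L` (`E_{ν₀}[h] = E_{ν₀'}[h ∘ L]`, `(∇(f∘L), Ċ'_0∇(f∘L)) = (∇f, Ċ₀∇f) ∘ L`).
The continuity assumption (e:continuity) of the fact is not needed (it is automatic in the nondegenerate
case, `PolchinskiContinuityAssumption.lean`, and the degenerate directions are excluded by 1.).

HONEST SCOPE.  This is [BBD] Theorem 3 in its finite-dimensional form `X ⊂ ℝ^N` exactly as typed in
`MultiscaleBakryEmery.lean` (conclusion on the test class `C¹_c`, `Ċ₀`-carré du champ; the typed
hypotheses «multiscale condition for all `φ ∈ ℝ^N`» and «`V_t ∈ C²` on `ℝ^N`» are stronger than the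
printed `φ ∈ X`, as recorded there).  A CRITERION: no lattice-gauge / Yang–Mills instance of
(e:assCt-mon) exists in print; nothing here bears on the Yang–Mills mass gap.

## References

* [BauerschmidtBodineauDagallier2023] R. Bauerschmidt, T. Bodineau, B. Dagallier, *Stochastic dynamics
  and the Polchinski equation: an introduction*, Probab. Surveys 21 (2024) 200–290, arXiv:2307.07619 —
  Theorem 3 p0015 L62–90; §3.1 p0012 L11–13, L56–61 (`X = im C_∞`). READ (held text
  `paper:arxiv-2307.07619`).
* [BauerschmidtBodineau2021SineGordonLSI] R. Bauerschmidt, T. Bodineau, Comm. Pure Appl. Math. 74 (2021)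
  2064–2113 — the criterion (their Theorem 2.5 / §2). READ (held text `paper:arxiv-1907.12308`).
-/

noncomputable section

open MeasureTheory ProbabilityTheory Filter Topology Set
open scoped RealInnerProductSpace Matrix MatrixOrder InnerProductSpace

namespace Literature.Analysis.FunctionSpaces

namespace Polchinski

/-- `(Bᵀ y, u) = (y, B u)`. [folklore] -/
private theorem transpose_mulVec_dotProduct_eq' {N N' : ℕ} (B : Matrix (Fin N) (Fin N') ℝ)
    (y : Fin N → ℝ) (u : Fin N' → ℝ) : (Bᵀ *ᵥ y) ⬝ᵥ u = y ⬝ᵥ (B *ᵥ u) := by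
  rw [Matrix.dotProduct_mulVec, Matrix.mulVec_transpose]

/-- A matrix killing `y − B Bᵀ y` for every `y` satisfies `S (B Bᵀ) = S`. [folklore] -/
private theorem mul_proj_eq_of_forall {N N' : ℕ} (B : Matrix (Fin N) (Fin N') ℝ)
    {S : Matrix (Fin N) (Fin N) ℝ} (h : ∀ y : Fin N → ℝ, S *ᵥ (y - B *ᵥ (Bᵀ *ᵥ y)) = 0) :
    S * (B * Bᵀ) = S := by
  refine Matrix.mulVec_injective (funext fun y => ?_)
  have hy := h y
  rw [Matrix.mulVec_sub, sub_eq_zero] at hy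
  rw [← Matrix.mulVec_mulVec, ← Matrix.mulVec_mulVec]
  exact hy.symm

/-- **[BBD] Theorem 3 (Bauerschmidt–Bodineau multiscale Bakry–Émery criterion) — the named fact
`Polchinski.BauerschmidtBodineau_multiscaleBakryEmery` HOLDS**, for every dimension `N` and every (possibly
degenerate) covariance decomposition: kernel rigidity (`PolchinskiKernelRigidity`) + reduction to an
orthonormal frame of `X = (ker C_∞)ᗮ` (`PolchinskiSubspaceReduction`) + the nondegenerate theorem
`logSobolev_of_multiscaleBakryEmery_of_bounded_below`.
[cite: BauerschmidtBodineauDagallier2023, Theorem 3] -/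
theorem BauerschmidtBodineau_multiscaleBakryEmery_holds :
    ∀ N : ℕ, BauerschmidtBodineau_multiscaleBakryEmery N := by
  intro N D V₀ lamdot lam hV hbV hC2 _hCA hMS hli hlam hexp f hf hfc
  obtain ⟨b, hb⟩ := hbV
  ---------------------------------------------------------------- the subspace `X = (ker C_∞)ᗮ` and a frame
  set Kinf : Submodule ℝ (EuclideanSpace ℝ (Fin N)) := LinearMap.ker (Matrix.toEuclideanLin D.Cinf)
    with hKinf
  set X : Submodule ℝ (EuclideanSpace ℝ (Fin N)) := Kinfᗮ with hX
  have hXorth : Xᗮ = Kinf := by rw [hX, Submodule.orthogonal_orthogonal]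
  have hmemK : ∀ y : EuclideanSpace ℝ (Fin N), y ∈ Kinf ↔ D.Cinf *ᵥ WithLp.ofLp y = 0 := by
    intro y
    rw [hKinf, LinearMap.mem_ker]
    constructor
    · intro h
      have h' := congrArg WithLp.ofLp h
      simpa [Matrix.ofLp_toLpLin, Matrix.toLin'_apply] using h'
    · intro h
      apply WithLp.ofLp_injective (p := 2)
      simpa [Matrix.ofLp_toLpLin, Matrix.toLin'_apply] using h
  set N' : ℕ := Module.finrank ℝ X with hN'
  obtain ⟨bX⟩ : Nonempty (OrthonormalBasis (Fin N') ℝ X) := ⟨stdOrthonormalBasis ℝ X⟩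
  set Liso : EuclideanSpace ℝ (Fin N') →ₗᵢ[ℝ] EuclideanSpace ℝ (Fin N) :=
    X.subtypeₗᵢ.comp bX.repr.symm.toLinearIsometry with hLiso
  set L : EuclideanSpace ℝ (Fin N') →L[ℝ] EuclideanSpace ℝ (Fin N) := Liso.toContinuousLinearMap with hL
  have hLapply : ∀ x, L x = Liso x := fun x => rfl
  have hLmem : ∀ x, L x ∈ X := fun x => by
    rw [hLapply, hLiso]
    exact Submodule.coe_mem _
  have hLsurj : ∀ p ∈ X, ∃ x, L x = p := by
    intro p hp
    refine ⟨bX.repr ⟨p, hp⟩, ?_⟩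
    rw [hLapply, hLiso]
    simp
  have hLinner : ∀ x y, ⟪L x, L y⟫ = ⟪x, y⟫ := fun x y => by
    rw [hLapply, hLapply]; exact Liso.inner_map_map x y
  ---------------------------------------------------------------- the matrix `B` of `L`
  set B : Matrix (Fin N) (Fin N') ℝ := Matrix.of fun i j => (L (EuclideanSpace.single j (1 : ℝ))) i
    with hBdef
  have hB : ∀ x : EuclideanSpace ℝ (Fin N'), WithLp.ofLp (L x) = B *ᵥ WithLp.ofLp x := by
    intro x
    have hx : x = ∑ j, x j • EuclideanSpace.single j (1 : ℝ) := by
      simpa [EuclideanSpace.basisFun_apply] using ((EuclideanSpace.basisFun (Fin N') ℝ).sum_repr x).symm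
    funext i
    conv_lhs => rw [hx]
    simp only [map_sum, map_smul, WithLp.ofLp_sum, WithLp.ofLp_smul, Finset.sum_apply, Pi.smul_apply,
      smul_eq_mul, Matrix.mulVec, dotProduct, hBdef, Matrix.of_apply]
    refine Finset.sum_congr rfl fun j _ => ?_
    rw [mul_comm]
  -- `⟪L x, y⟫ = (y, B x)` and vectors of the form `B (Bᵀ y)` are images under `L`
  have hinnerL : ∀ (x : EuclideanSpace ℝ (Fin N')) (y : EuclideanSpace ℝ (Fin N)),
      ⟪L x, y⟫ = WithLp.ofLp y ⬝ᵥ (B *ᵥ WithLp.ofLp x) := by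
    intro x y
    rw [EuclideanSpace.inner_eq_star_dotProduct, star_trivial, hB]
  have hBBt : ∀ y : Fin N → ℝ, B *ᵥ (Bᵀ *ᵥ y) = WithLp.ofLp (L (WithLp.toLp 2 (Bᵀ *ᵥ y))) := by
    intro y; rw [hB]
  ---------------------------------------------------------------- every covariance is blind to `Xᗮ`
  have hproj : ∀ y : Fin N → ℝ, D.Cinf *ᵥ (y - B *ᵥ (Bᵀ *ᵥ y)) = 0 := by
    intro y
    have hmem : WithLp.toLp 2 y - L (WithLp.toLp 2 (Bᵀ *ᵥ y)) ∈ Kinf := by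
      rw [← hXorth, Submodule.mem_orthogonal]
      intro p hp
      obtain ⟨x, rfl⟩ := hLsurj p hp
      rw [inner_sub_right, hLinner, hinnerL, EuclideanSpace.inner_eq_star_dotProduct, star_trivial]
      rw [transpose_mulVec_dotProduct_eq', sub_self]
    have h := (hmemK _).1 hmem
    rw [WithLp.ofLp_sub, hBBt] at *
    simpa using h
  have hCinfP : D.Cinf * (B * Bᵀ) = D.Cinf := mul_proj_eq_of_forall B hproj
  have hCP : ∀ t, 0 ≤ t → D.C t * (B * Bᵀ) = D.C t := fun t ht =>
    mul_proj_eq_of_forall B fun y => mulVec_C_eq_zero_of_mulVec_Cinf_eq_zero D _ (hproj y) ht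
  have hCdotP : ∀ t, 0 ≤ t → D.Cdot t * (B * Bᵀ) = D.Cdot t := fun t ht =>
    mul_proj_eq_of_forall B fun y => mulVec_Cdot_eq_zero_of_mulVec_Cinf_eq_zero D _ (hproj y) ht
  ---------------------------------------------------------------- kernel rigidity ⟹ `C_t B` injective (`t > 0`)
  have hinj : ∀ t, 0 < t → ∀ x : Fin N' → ℝ, D.C t *ᵥ (B *ᵥ x) = 0 → x = 0 := by
    intro t ht x hx
    have hx' : D.Cinf *ᵥ (B *ᵥ x) = 0 :=
      (mulVec_C_eq_zero_iff_mulVec_Cinf_eq_zero D hV hb hC2 hMS hli (B *ᵥ x) ht).1 hx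
    have hmemK' : L (WithLp.toLp 2 x) ∈ Kinf := by
      rw [hmemK, hB]
      exact hx'
    have hmemX : L (WithLp.toLp 2 x) ∈ X := hLmem _
    have h0 : L (WithLp.toLp 2 x) = 0 := by
      have h := Submodule.inner_right_of_mem_orthogonal hmemX (by rw [hXorth]; exact hmemK')
      exact inner_self_eq_zero.1 h
    have h1 : WithLp.toLp 2 x = 0 := by
      rw [hLapply] at h0
      exact Liso.injective (by rw [h0, map_zero])
    have h2 := congrArg WithLp.ofLp h1
    simpa using h2
  ---------------------------------------------------------------- the reduced decomposition
  obtain ⟨D', hC', hCdot', hCddot', hCinf'⟩ := exists_reduced D B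
  have hpos : ∀ t, 0 < t → (D'.C t).PosDef := fun t ht => by
    rw [hC' t]
    exact posDef_reduce B (D.posSemidef_C ht.le) (hinj t ht)
  have hV' : Measurable fun z : EuclideanSpace ℝ (Fin N') => V₀ (L z) := hV.comp L.continuous.measurable
  have hb' : ∀ z : EuclideanSpace ℝ (Fin N'), b ≤ V₀ (L z) := fun z => hb (L z)
  have hMS' : MultiscaleCondition D' (fun z => V₀ (L z)) lamdot :=
    multiscaleCondition_reduce D L B hB hV hC' hCdot' hCddot' hCP hCdotP hC2 hMS
  have hf' : ContDiff ℝ 1 fun z : EuclideanSpace ℝ (Fin N') => f (L z) := hf.comp L.contDiff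
  have hfc' : HasCompactSupport fun z : EuclideanSpace ℝ (Fin N') => f (L z) :=
    hfc.comp_isClosedEmbedding Liso.isometry.isClosedEmbedding
  ---------------------------------------------------------------- the nondegenerate theorem on `ℝ^{N'}`
  have key := logSobolev_of_multiscaleBakryEmery_of_bounded_below D' hpos hV' hb' hMS' hli hlam hexp
    (fun z => f (L z)) hf' hfc'
  ---------------------------------------------------------------- transport back along `L`
  have hfcont : Continuous f := hf.continuous
  have hfd : Differentiable ℝ f := hf.differentiable one_ne_zero
  have hgcont : Continuous (gradient f) := by
    have hgrad : gradient f = fun x => (InnerProductSpace.toDual ℝ (EuclideanSpace ℝ (Fin N))).symm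
        (fderiv ℝ f x) := rfl
    rw [hgrad]
    exact (InnerProductSpace.toDual ℝ (EuclideanSpace ℝ (Fin N))).symm.continuous.comp
      (hf.continuous_fderiv one_ne_zero)
  have hm₁ : Measurable fun φ : EuclideanSpace ℝ (Fin N) => f φ ^ 2 * Real.log (f φ ^ 2) :=
    (Real.continuous_mul_log.comp (hfcont.pow 2)).measurable
  have hm₂ : Measurable fun φ : EuclideanSpace ℝ (Fin N) => f φ ^ 2 := (hfcont.pow 2).measurable
  have hm₃ : Measurable fun φ : EuclideanSpace ℝ (Fin N) =>
      ⟪gradient f φ, Matrix.toEuclideanLin (D.Cdot 0) (gradient f φ)⟫ :=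
    (hgcont.inner ((Matrix.toEuclideanLin (D.Cdot 0)).continuous_of_finiteDimensional.comp
      hgcont)).measurable
  have e3 : (fun x : EuclideanSpace ℝ (Fin N') => ⟪gradient (fun z => f (L z)) x,
      Matrix.toEuclideanLin (D'.Cdot 0) (gradient (fun z => f (L z)) x)⟫) =
      fun x => (fun φ : EuclideanSpace ℝ (Fin N) =>
        ⟪gradient f φ, Matrix.toEuclideanLin (D.Cdot 0) (gradient f φ)⟫) (L x) :=
    funext fun x => inner_gradient_reduce D L B hB hCdot' hCdotP hfd x
  rw [e3, ← integral_nu0_reduce D L B hB hV hCinf' hCinfP hm₃,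
    ← integral_nu0_reduce D L B hB hV hCinf' hCinfP (h := fun φ => f φ ^ 2 * Real.log (f φ ^ 2)) hm₁,
    ← integral_nu0_reduce D L B hB hV hCinf' hCinfP (h := fun φ => f φ ^ 2) hm₂] at key
  exact key

end Polchinski

end Literature.Analysis.FunctionSpaces

end
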